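import Summits.Langlands.Langlands.Theorems.IrregularClassicality.Negative.EmbeddingWLOG
import Summits.Langlands.Langlands.Theorems.IrregularClassicality.Negative.FiniteRangeCollapse

/-!
# `IrregularClassicality` (stmt-Langlands-13758) — Negative knowledge IV: one normal form
# (fixed embedding, large `S`, cofinal depths, no recurring eigensystem)

From the standing disprover's `Cruxes/IrregularClassicality/Disproof.lean`, cdisprove cycle 2
(2026-08-16), §11.  The crux is not refuted; this file packages, as two EQUIVALENCES with the
crux, everything a prover may assume for free about its limit hypothesis:

* `irregularClassicality_iff_normal_form e₀ S₀` — fix ONE embedding `e₀` of `ℚ(ω)` on both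
  sides (`irregularClassicality_iff_fixed`), assume the exceptional set `S` contains any
  prescribed finite set `S₀ f` (layers are monotone in `S`), and assume the tower only at
  cofinally many depths (layers are antitone in the depth);
* `irregularClassicality_iff_nonrecurring e₀` — additionally assume that NO Satake eigensystem
  off `S` recurs at infinitely many depths: a recurring one already gives the conclusion
  (`automorphy_of_recurring_eigensystem`, Negative knowledge III), so the crux's content is
  exactly the towers running through infinitely many distinct eigensystems.

Mathlib + `Negative/EmbeddingWLOG` + `Negative/FiniteRangeCollapse` only. [folklore]
-/

set_option linter.dupNamespace false

namespace Summit.Langlands.Langlands.Theorems.IrregularClassicality.Negative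

open Literature.NumberTheory.Automorphic Literature.NumberTheory.GaloisRepresentations
open NumberField IsDedekindDomain Polynomial Filter

open scoped Classical

/-- **Normal form of `IrregularClassicality`.**  For any fixed embedding `e₀ : ℚ(ω) → ℂ` and any
assignment `S₀` of a finite set of places to each quartic (e.g. the primes above `3·disc f·lead f`):
the crux holds iff for every generic `f`, every maximal `𝔐 ∋ 3` of `ℤ̄`, every finite `S ⊇ S₀ f`,
a tower of regular algebraic cuspidal `P` serving COFINALLY MANY depths
(`∀ k, ∃ l ≥ k, ∃ P_l, N𝔭·Σα(P_l,𝔭) ≡ e₀(a_𝔭(f)) (mod 3^l ℤ̄_𝔐)` off `S`) yields a cuspidal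
L-algebraic `π` with `Σ Satake(π,𝔭) = e₀(a_𝔭(f))` a.e.  (`→`: antitone layers; `←`: enlarge `S`
to `S ∪ S₀ f`, layers are monotone in `S`; both sides at `e₀` by `irregularClassicality_iff_fixed`.)
[folklore] -/
theorem irregularClassicality_iff_normal_form (e₀ : CyclotomicField 3 ℚ →+* ℂ)
    (S₀ : ℤ[X] → Finset (HeightOneSpectrum (𝓞 (CyclotomicField 3 ℚ)))) :
    Summit.Langlands.Langlands.Theses.PicardMuOrdinary.IrregularClassicality ↔
      ∀ (f : ℤ[X]) (hcpt : isCompact_glFiniteIntegralLevel 3 (CyclotomicField 3 ℚ)),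
        f.natDegree = 4 → (f.map (Int.castRingHom ℚ)).Separable →
        12 ∣ Nat.card (f.map (Int.castRingHom ℚ)).Gal →
        ∀ (𝔐 : Ideal (integralClosure ℤ ℂ)) (S : Finset (HeightOneSpectrum (𝓞 (CyclotomicField 3 ℚ)))),
          𝔐.IsMaximal → (3 : integralClosure ℤ ℂ) ∈ 𝔐 → S₀ f ⊆ S →
          (∀ k : ℕ, ∃ l, k ≤ l ∧
            ∃ P : CuspidalAutomorphicRepData 3 (CyclotomicField 3 ℚ) hcpt, P.1.IsRegularAlgebraic ∧
              ∀ 𝔭 ∉ S, ∃ (α : Multiset ℂ) (t u : integralClosure ℤ ℂ), P.1.HasSatakeParamAt 𝔭 α ∧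
                (t : ℂ) = (𝔭.residueCard : ℂ) * α.sum - e₀ (picardTrace f 𝔭) ∧ u ∉ 𝔐 ∧
                u * t ∈ Ideal.span {(3 : integralClosure ℤ ℂ) ^ l}) →
          ∃ π : CuspidalAutomorphicRepData 3 (CyclotomicField 3 ℚ) hcpt, π.1.IsLAlgebraic ∧
            ∀ᶠ 𝔭 : HeightOneSpectrum (𝓞 (CyclotomicField 3 ℚ)) in cofinite, ∃ α : Multiset ℂ,
              π.1.HasSatakeParamAt 𝔭 α ∧ α.sum = e₀ (picardTrace f 𝔭) := by
  rw [irregularClassicality_iff_fixed e₀]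
  constructor
  · intro h f hcpt hdeg hsep hgal 𝔐 S h𝔐 h3 _ hk
    refine h f hcpt hdeg hsep hgal ⟨𝔐, S, h𝔐, h3, fun k => ?_⟩
    obtain ⟨l, hkl, P, hP, hl⟩ := hk k
    refine ⟨P, hP, fun 𝔭 h𝔭 => ?_⟩
    obtain ⟨α, t, u, hα, ht, hu, hut⟩ := hl 𝔭 h𝔭
    exact ⟨α, t, u, hα, ht, hu, Ideal.span_singleton_le_span_singleton.2 (pow_dvd_pow 3 hkl) hut⟩
  · intro h f hcpt hdeg hsep hgal hL
    obtain ⟨𝔐, S, h𝔐, h3, hk⟩ := hL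
    refine h f hcpt hdeg hsep hgal 𝔐 (S ∪ S₀ f) h𝔐 h3 Finset.subset_union_right fun k => ?_
    obtain ⟨P, hP, hS⟩ := hk k
    exact ⟨k, le_rfl, P, hP, fun 𝔭 h𝔭 => hS 𝔭 fun h𝔭S => h𝔭 (Finset.mem_union_left _ h𝔭S)⟩

/-- **Normal form without recurring eigensystems.**  For any fixed embedding `e₀`: the crux holds
iff its conclusion (at `e₀`) follows, for every generic `f`, maximal `𝔐 ∋ 3` and finite `S`, from
a full tower at `e₀` in which NO Satake function `A` off `S` recurs — i.e. there is no `A` such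
that at infinitely many depths some regular algebraic cuspidal `P` with Satake parameters `A` off
`S` serves the depth.  (The recurring case is discharged by `automorphy_of_recurring_eigensystem`.)
So the content of `IrregularClassicality` is exactly the towers through infinitely many distinct
eigensystems — on paper, of unbounded weight. [folklore] -/
theorem irregularClassicality_iff_nonrecurring (e₀ : CyclotomicField 3 ℚ →+* ℂ) :
    Summit.Langlands.Langlands.Theses.PicardMuOrdinary.IrregularClassicality ↔
      ∀ (f : ℤ[X]) (hcpt : isCompact_glFiniteIntegralLevel 3 (CyclotomicField 3 ℚ)),
        f.natDegree = 4 → (f.map (Int.castRingHom ℚ)).Separable →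
        12 ∣ Nat.card (f.map (Int.castRingHom ℚ)).Gal →
        ∀ (𝔐 : Ideal (integralClosure ℤ ℂ)) (S : Finset (HeightOneSpectrum (𝓞 (CyclotomicField 3 ℚ)))),
          𝔐.IsMaximal → (3 : integralClosure ℤ ℂ) ∈ 𝔐 →
          (∀ A : HeightOneSpectrum (𝓞 (CyclotomicField 3 ℚ)) → Multiset ℂ,
            ¬ ∀ k : ℕ, ∃ l, k ≤ l ∧
              ∃ P : CuspidalAutomorphicRepData 3 (CyclotomicField 3 ℚ) hcpt, P.1.IsRegularAlgebraic ∧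
                (∀ 𝔭 ∉ S, P.1.HasSatakeParamAt 𝔭 (A 𝔭)) ∧
                ∀ 𝔭 ∉ S, ∃ (α : Multiset ℂ) (t u : integralClosure ℤ ℂ), P.1.HasSatakeParamAt 𝔭 α ∧
                  (t : ℂ) = (𝔭.residueCard : ℂ) * α.sum - e₀ (picardTrace f 𝔭) ∧ u ∉ 𝔐 ∧
                  u * t ∈ Ideal.span {(3 : integralClosure ℤ ℂ) ^ l}) →
          (∀ k : ℕ, ∃ P : CuspidalAutomorphicRepData 3 (CyclotomicField 3 ℚ) hcpt,
            P.1.IsRegularAlgebraic ∧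
            ∀ 𝔭 ∉ S, ∃ (α : Multiset ℂ) (t u : integralClosure ℤ ℂ), P.1.HasSatakeParamAt 𝔭 α ∧
              (t : ℂ) = (𝔭.residueCard : ℂ) * α.sum - e₀ (picardTrace f 𝔭) ∧ u ∉ 𝔐 ∧
              u * t ∈ Ideal.span {(3 : integralClosure ℤ ℂ) ^ k}) →
          ∃ π : CuspidalAutomorphicRepData 3 (CyclotomicField 3 ℚ) hcpt, π.1.IsLAlgebraic ∧
            ∀ᶠ 𝔭 : HeightOneSpectrum (𝓞 (CyclotomicField 3 ℚ)) in cofinite, ∃ α : Multiset ℂ,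
              π.1.HasSatakeParamAt 𝔭 α ∧ α.sum = e₀ (picardTrace f 𝔭) := by
  rw [irregularClassicality_iff_fixed e₀]
  constructor
  · intro h f hcpt hdeg hsep hgal 𝔐 S h𝔐 h3 _ hk
    exact h f hcpt hdeg hsep hgal ⟨𝔐, S, h𝔐, h3, hk⟩
  · intro h f hcpt hdeg hsep hgal hL
    obtain ⟨𝔐, S, h𝔐, h3, hk⟩ := hL
    by_cases hrec : ∃ A : HeightOneSpectrum (𝓞 (CyclotomicField 3 ℚ)) → Multiset ℂ,
        ∀ k : ℕ, ∃ l, k ≤ l ∧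
          ∃ P : CuspidalAutomorphicRepData 3 (CyclotomicField 3 ℚ) hcpt, P.1.IsRegularAlgebraic ∧
            (∀ 𝔭 ∉ S, P.1.HasSatakeParamAt 𝔭 (A 𝔭)) ∧
            ∀ 𝔭 ∉ S, ∃ (α : Multiset ℂ) (t u : integralClosure ℤ ℂ), P.1.HasSatakeParamAt 𝔭 α ∧
              (t : ℂ) = (𝔭.residueCard : ℂ) * α.sum - e₀ (picardTrace f 𝔭) ∧ u ∉ 𝔐 ∧
              u * t ∈ Ideal.span {(3 : integralClosure ℤ ℂ) ^ l}
    · obtain ⟨A, hA⟩ := hrec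
      exact (automorphyConclusion_iff_fixed e₀ f hcpt).1
        (automorphy_of_recurring_eigensystem e₀ h𝔐 h3 S A hA)
    · exact h f hcpt hdeg hsep hgal 𝔐 S h𝔐 h3 (not_exists.1 hrec) hk

end Summit.Langlands.Langlands.Theorems.IrregularClassicality.Negative
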